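import Literature.Topology.FourManifolds.SphereFamilySurgery
import Literature.Topology.FourManifolds.RegularLevelSplitting
import Literature.Topology.FourManifolds.RegularDomainMaps
import Literature.Topology.FourManifolds.InteriorSmoothEmbedding
import Literature.Topology.FourManifolds.InteriorDiscs
import Literature.Topology.FourManifolds.FramedSphereFamilyOfCharts
import Literature.Topology.FourManifolds.FramedSphereFamilyTransversality
import HarnessLib

/-!
# A framed sphere family inside a regular domain is a framed sphere family of the domain

Topic `Literature/Topology/FourManifolds` (fact seat
`provefact-Literature.Topology.FourManifolds.Matvey-69322e0896`, rung (H4)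
`Literature.Topology.FourManifolds.Matveyev1996_partOne_and_fact_of_dualSpheres` of
`CorkDecompositionMiddleLevel.lean`; vocabulary of `SphereFamilySurgery.lean` and
`RegularLevelSplitting.lean`).  Matveyev 1996 (arXiv:dg-ga/9505001), Proof of Theorem, step 3:
*"Surgery of `V₃` along collections of embedded spheres `{Sᵢ}` and `{Pᵢ}` gives two
contractible sub-manifolds `W₁` and `W₂`"* — the surgeries are performed **inside the compact
domain `V₃ ⊂ N`**, a regular sublevel set `{g ≤ 0}` of the tree (Milnor, *Morse theory* (1963),
Thm. 3.1: `Mᵃ = f⁻¹(-∞, a]` is a smooth manifold with boundary, `RegularSublevel`), so the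
framed families of `N` (Milnor 1965, Def. 3.9: characteristic embeddings `φ : Sᵏ × ℝᵐ → N`)
whose tubes lie in the open part `{g < a}` must be read as framed families *of the manifold with
boundary `{g ≤ a}`*.  This file proves that reading: the corestriction of each `φᵢ` is a smooth
embedding into `{g ≤ a}` for the model with boundary `𝓡∂ (n + 1)` (through the interior
manifold of the tree, `InteriorManifold.isSmoothEmbedding_val_comp`: an open smooth embedding
into the interior `{g < a}` — a boundaryless manifold — followed by the inclusion of the
interior), with open, pairwise disjoint ranges.  Everything here is proved; no definitions, no
named facts:

* **`Literature.Topology.FourManifolds.FramedSphereFamily.exists_restrict_regularSublevel`** —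
  for a framed family `φ` of `N` with `g ∘ φᵢ < a` on all of `Sᵏ × ℝᵐ` there is a framed family
  `φ^V` of `V = {g ≤ a}` with `incl ∘ φ^Vᵢ = φᵢ`.

## References

* R. Matveyev, *A decomposition of smooth simply-connected h-cobordant 4-manifolds*,
  J. Differential Geom. 44 (1996) 571–582; arXiv:dg-ga/9505001, Proof of Theorem, step 3.
  [Matveyev1996]
* J. Milnor, *Morse theory*, Ann. of Math. Studies 51 (1963), Thm. 3.1. [Milnor1963]
* J. Milnor, *Lectures on the h-cobordism theorem*, Princeton (1965), Def. 3.9, Def. 4.5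
  (PDF pp. 16, 23). [MilnorHCobordism1965]
* T. Bröcker, K. Jänich, *Introduction to Differential Topology* (1982), (13.3).
  [BrockerJanich1982]
-/

noncomputable section

open scoped Manifold ContDiff Topology
open Set Function Metric

namespace Literature.Topology.FourManifolds

universe u v

namespace FramedSphereFamily

variable {n k m : ℕ} {N : Type u} [TopologicalSpace N]
  [ChartedSpace (EuclideanSpace ℝ (Fin (n + 1))) N] [IsManifold (𝓡 (n + 1)) ∞ N]
  {ι : Type v} {g : N → ℝ} {a : ℝ}

/-- **A framed family of `N` with tubes in `{g < a}` is a framed family of the regular domain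
`V = {g ≤ a}`** (Milnor 1963, Thm. 3.1, with Milnor 1965, Def. 3.9): if `a` is a regular value of
`g` and `g (φᵢ q) < a` for all `q ∈ Sᵏ × ℝᵐ` (`k + m = n + 1`), there is a framed family
`φ^V` of the manifold with boundary `V = {g ≤ a}` (`RegularSublevel h`, model `𝓡∂ (n + 1)`) with
`incl ∘ φ^Vᵢ = φᵢ`: each `φ^Vᵢ` is an open smooth embedding into the interior `{g < a}`
composed with the inclusion of the interior (Bröcker–Jänich (13.3)).
[cite: Milnor1963, Thm. 3.1] [cite: MilnorHCobordism1965, Def. 3.9 (PDF p. 16)]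
[cite: BrockerJanich1982, (13.3)] -/
theorem exists_restrict_regularSublevel (h : IsRegularLevel (𝓡 (n + 1)) g a) (hkm : k + m = n + 1)
    (ν : FramedSphereFamily (𝓡 (n + 1)) N ι k m) (hν : ∀ i q, g (ν.toFun i q) < a) :
    ∃ νV : FramedSphereFamily (𝓡∂ (n + 1)) (RegularSublevel h) ι k m,
      ∀ i q, RegularSublevel.incl h (νV.toFun i q) = ν.toFun i q := by
  -- the corestrictions `φ^Vᵢ : Sᵏ × ℝᵐ → V` and their lifts to the interior manifold
  let fV : ι → (Metric.sphere (0 : EuclideanSpace ℝ (Fin (k + 1))) 1 × EuclideanSpace ℝ (Fin m)) →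
      RegularSublevel h := fun i q => RegularSublevel.mk h (ν.toFun i q) (hν i q).le
  have hfV : ∀ i q, RegularSublevel.incl h (fV i q) = ν.toFun i q := fun i q => rfl
  have hsm : ∀ i, ContMDiff ((𝓡 k).prod 𝓘(ℝ, EuclideanSpace ℝ (Fin m))) (𝓡∂ (n + 1)) ∞ (fV i) :=
    fun i => (RegularSublevel.halfSliceAtlas h).contMDiff_codRestrict (fun q => (hν i q).le)
      (ν.contMDiff i)
  have hint : ∀ i q, (𝓡∂ (n + 1)).IsInteriorPoint (fV i q) := fun i q =>
    (RegularSublevel.isInteriorPoint_iff h _).2 (hν i q)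
  let gI : ι → (Metric.sphere (0 : EuclideanSpace ℝ (Fin (k + 1))) 1 × EuclideanSpace ℝ (Fin m)) →
      InteriorManifold (𝓡∂ (n + 1)) (RegularSublevel h) := fun i => InteriorManifold.lift (fV i)
          (hint i)
  have hgIv : ∀ i q, (gI i q).val = fV i q := fun i q => rfl
  have hgIsm : ∀ i, ContMDiff ((𝓡 k).prod 𝓘(ℝ, EuclideanSpace ℝ (Fin m)))
      𝓘(ℝ, EuclideanSpace ℝ (Fin (n + 1))) ∞ (gI i) := fun i =>
    InteriorManifold.contMDiff_lift (hsm i) (hint i)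
  -- `incl ∘ val` is injective and an embedding, so each `gI i` is an open embedding
  have hiv : Topology.IsEmbedding (fun x : InteriorManifold (𝓡∂ (n + 1)) (RegularSublevel h) =>
      RegularSublevel.incl h x.val) :=
    (RegularSublevel.isEmbedding_incl h).comp InteriorManifold.isEmbedding_val
  have hivinj : Injective (fun x : InteriorManifold (𝓡∂ (n + 1)) (RegularSublevel h) =>
      RegularSublevel.incl h x.val) :=
    (RegularSublevel.injective_incl h).comp InteriorManifold.val_injective
  have hcomp : ∀ i, (fun x : InteriorManifold (𝓡∂ (n + 1)) (RegularSublevel h) =>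
      RegularSublevel.incl h x.val) ∘ gI i = ν.toFun i := fun i => rfl
  have hrange : ∀ i, range (gI i) = (fun x : InteriorManifold (𝓡∂ (n + 1)) (RegularSublevel h) =>
      RegularSublevel.incl h x.val) ⁻¹' range (ν.toFun i) := fun i => by
    ext x
    constructor
    · rintro ⟨q, rfl⟩
      exact ⟨q, rfl⟩
    · rintro ⟨q, hq⟩
      exact ⟨q, hivinj (by rw [← hq]; rfl)⟩
  have hopen : ∀ i, IsOpen (range (gI i)) := fun i => by
    rw [hrange i]
    exact (ν.isOpen_range i).preimage hiv.continuous
  have hge : ∀ i, Topology.IsOpenEmbedding (gI i) := fun i =>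
    ⟨Topology.IsEmbedding.of_comp (hgIsm i).continuous hiv.continuous
      (by rw [hcomp i]; exact (ν.isSmoothEmbedding i).isEmbedding), hopen i⟩
  -- each `gI i` as a globally defined partial homeomorphism, smooth with smooth inverse
  have hL : (EuclideanSpace ℝ (Fin k) × EuclideanSpace ℝ (Fin m)) ≃L[ℝ]
      EuclideanSpace ℝ (Fin (n + 1)) := prodEuclideanEquiv hkm
  have hemb : ∀ i, Manifold.IsSmoothEmbedding ((𝓡 k).prod 𝓘(ℝ, EuclideanSpace ℝ (Fin m)))
      𝓘(ℝ, EuclideanSpace ℝ (Fin (n + 1))) ∞ (gI i) := by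
    intro i
    classical
    rcases isEmpty_or_nonempty (Metric.sphere (0 : EuclideanSpace ℝ (Fin (k + 1))) 1 ×
        EuclideanSpace ℝ (Fin m)) with he | hne
    · exact ⟨Manifold.IsImmersionOfComplement.isImmersion (F := Unit)
        fun q => (he.false q).elim, (hge i).isEmbedding⟩
    · obtain ⟨K, hKs, hKt, hKap, -, hKsymm⟩ := ν.exists_tube_openPartialHomeomorph i
      set Φ : OpenPartialHomeomorph _ (InteriorManifold (𝓡∂ (n + 1)) (RegularSublevel h)) :=
        (hge i).toOpenPartialHomeomorph (gI i) with hΦdef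
      have hΦsrc : Φ.source = univ := Topology.IsOpenEmbedding.toOpenPartialHomeomorph_source _ _
      have hΦtgt : Φ.target = range (gI i) :=
          Topology.IsOpenEmbedding.toOpenPartialHomeomorph_target _ _
      have hΦap : ∀ q, Φ q = gI i q := fun q => rfl
      have hΦ : ContMDiffOn ((𝓡 k).prod 𝓘(ℝ, EuclideanSpace ℝ (Fin m)))
          𝓘(ℝ, EuclideanSpace ℝ (Fin (n + 1))) ∞ Φ Φ.source := (hgIsm i).contMDiffOn
      -- the inverse is `K⁻¹ ∘ incl ∘ val` on the range
      have hinv : ∀ x ∈ Φ.target, Φ.symm x = K.symm (RegularSublevel.incl h x.val) := by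
        intro x hx
        rw [hΦtgt] at hx
        obtain ⟨q, rfl⟩ := hx
        rw [show gI i q = Φ q from rfl, Φ.left_inv (by rw [hΦsrc]; exact mem_univ q)]
        show q = K.symm (ν.toFun i q)
        rw [← hKap, K.left_inv (by rw [hKs]; exact mem_univ q)]
      have hΦ' : ContMDiffOn 𝓘(ℝ, EuclideanSpace ℝ (Fin (n + 1)))
          ((𝓡 k).prod 𝓘(ℝ, EuclideanSpace ℝ (Fin m))) ∞ Φ.symm Φ.target := by
        have h1 : ContMDiff 𝓘(ℝ, EuclideanSpace ℝ (Fin (n + 1))) (𝓡 (n + 1)) ∞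
            (fun x : InteriorManifold (𝓡∂ (n + 1)) (RegularSublevel h) =>
              RegularSublevel.incl h x.val) :=
          (RegularSublevel.contMDiff_incl h).comp InteriorManifold.contMDiff_val
        have h2 : ContMDiffOn 𝓘(ℝ, EuclideanSpace ℝ (Fin (n + 1)))
            ((𝓡 k).prod 𝓘(ℝ, EuclideanSpace ℝ (Fin m))) ∞
            (fun x : InteriorManifold (𝓡∂ (n + 1)) (RegularSublevel h) =>
              K.symm (RegularSublevel.incl h x.val)) Φ.target := by
          refine hKsymm.comp h1.contMDiffOn fun x hx => ?_
          rw [hΦtgt, hrange i] at hx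
          rw [hKt]
          exact hx
        exact h2.congr hinv
      exact isSmoothEmbedding_of_openPartialHomeomorph Φ hΦsrc hΦ hΦ' hL
  refine ⟨{ toFun := fV
            isSmoothEmbedding := fun i =>
              InteriorManifold.isSmoothEmbedding_val_comp (hemb i) (hopen i) hL
            isOpen_range := fun i => InteriorManifold.isOpen_range_val_comp (hopen i)
            disjoint_range := fun i j hij => by
              refine Set.disjoint_iff_forall_ne.2 ?_
              rintro _ ⟨q, rfl⟩ _ ⟨q', rfl⟩ heq
              have heq' : ν.toFun i q = ν.toFun j q' := by
                rw [← hfV i q, ← hfV j q']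
                exact congrArg (RegularSublevel.incl h) heq
              exact Set.disjoint_iff_forall_ne.1 (ν.disjoint_range hij) ⟨q, rfl⟩ ⟨q', rfl⟩ heq' },
    hfV⟩

end FramedSphereFamily

end Literature.Topology.FourManifolds

end
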